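import Summits.AtomisticToContinuum.BoseEinsteinCondensation.Theorems.BECRichardsonGaudinRichardsonAnchorBECDefs
import Summits.AtomisticToContinuum.BoseEinsteinCondensation.Theorems.BECRichardsonGaudinRichardsonAnchorBECBornDefs
import Summits.AtomisticToContinuum.BoseEinsteinCondensation.Theorems.BECRichardsonGaudinRichardsonAnchorBECModeAnSectorWave
import Summits.AtomisticToContinuum.BoseEinsteinCondensation.Theorems.BECRichardsonGaudinRichardsonAnchorBECBandKineticLower
import Summits.AtomisticToContinuum.BoseEinsteinCondensation.Theorems.BECRichardsonGaudinRichardsonAnchorBECPenalisedLowerBoundCore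
import Summits.AtomisticToContinuum.BoseEinsteinCondensation.Theorems.BECGroundStateSOSPeriodicIRBoundFsumDichotomy
import Literature.MathematicalPhysics.QuantumManyBody.TorusFockSectorDictionary
import Literature.MathematicalPhysics.QuantumManyBody.TorusFockLayer
import HarnessLib

/-!
# Crux `RichardsonAnchorBEC` (stmt-AtomisticToContinuum-14805), route `BECRichardsonGaudin`, line `registered` —
# stub `stub_anchorESector`: the anchor functional of a sector trial state in Fock-space form

For a non-zero homogeneous polynomial `A` of degree `N = n + 2` over the band modes
`ι = ↥(momentumBand M)`, `M = ⌊ΛL/2π⌋`, `L = L_N(ρ)`, let `Ψ = Ψ_A/‖Ψ_A‖` be its sector trial state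
(`TorusFockSectorDictionary.sectorTrialState`, `Ψ = c Ψ_A`, `c = (√((L³)^N ‖A‖²))⁻¹`). We prove that the
anchor functional `E_κ(Ψ) = ∫|∇Ψ|² + κ(N − n₀(Ψ)) + (γ/L⁹)(N(N−1)/2)∫|∫∫ conj(w_M) Ψ|²` is (bounded by, in
fact equal to) the Fock-space expression
`[Σ_p (|k_p|² + κ[p ≠ 0]) ‖∂_p A‖² + (γ/2L³) ‖Σ_p ∂_{-p}∂_p A‖²] / ‖A‖²`, term by term:

* kinetic: `periodicInteraction_zero` and `lintegral_kineticDensity_sectorTrialState`;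
* condensate: `condensateOccupation_eq_normSq_modeAn` (`n₀ = ‖a_0 Ψ‖²`), the landed dictionary
  `stub_modeAnSectorWave` (`a(φ_p) Ψ_A = √(L³) Ψ_{∂_p A}`), `integral_cellN_norm_sq_sectorWave` and the
  Euler identity `Fock.sum_fockInner_pderiv_pderiv` (`Σ_p ‖∂_p A‖² = N‖A‖²`), giving
  `N − n₀ = Σ_{p ≠ 0} ‖∂_p A‖²/‖A‖²`;
* pair term (after unfolding `anchorE` by the tree's `anchorE_eq`): the landed conversion
  `stub_bandKineticLower` (c) (`… = (γ/2L³) ‖Σ_{k ∈ B_M} a_{-k} a_k Ψ‖²`), the dictionary twice and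
  additivity of `sectorWave` in the sector, giving `‖Σ_k a_{-k}a_k Ψ‖² = ‖Σ_p ∂_{-p}∂_p A‖²/‖A‖²`.
-/

noncomputable section

open MeasureTheory Filter
open scoped ENNReal NNReal ComplexConjugate BigOperators

namespace Summit.AtomisticToContinuum.BoseEinsteinCondensation.Cruxes.RichardsonAnchorBEC.Birth

open Literature.MathematicalPhysics.QuantumManyBody.BoseGas
open Summit.AtomisticToContinuum.BoseEinsteinCondensation.Cruxes.PeriodicIRBound.LinearPhFloorWagner.WF
open Summit.AtomisticToContinuum.BoseEinsteinCondensation.Cruxes.PeriodicIRBound.FsumPhasePencil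
  (condensateOccupation_eq_normSq_modeAn)
open MvPolynomial

/-! ## Generic facts on sector wave functions -/

/-- The sector wave function is additive over finite sums of sectors:
`Ψ_{Σ_i A_i} = Σ_i Ψ_{A_i}`. [folklore] -/
theorem aes_sectorWave_finset_sum {ι : Type*} [Fintype ι] {σ : Type*} (L : ℝ) (e : ι → Momentum)
    (s : Finset σ) (f : σ → MvPolynomial ι ℂ) (m : ℕ) (X : Config m) :
    sectorWave L e (∑ i ∈ s, f i) m X = ∑ i ∈ s, sectorWave L e (f i) m X := by
  unfold sectorWave
  simp only [Fock.amp, coeff_sum, Finset.mul_sum, Finset.sum_mul]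
  exact Finset.sum_comm

/-- The `L²(Λ^m)` mass of a sector wave function in `ℝ≥0∞`: `‖Ψ_B‖² = (L³)^m ‖B‖²` for `B`
homogeneous of degree `m`. [folklore] -/
theorem aes_normSq_sectorWave {ι : Type*} [Fintype ι] [DecidableEq ι] {L : ℝ} (hL : 0 < L)
    {e : ι → Momentum} (he : Function.Injective e) {m : ℕ} {B : MvPolynomial ι ℂ}
    (hB : B.IsHomogeneous m) :
    normSq L (sectorWave L e B m) = ENNReal.ofReal ((L ^ 3) ^ m * (Fock.fockInner B B).re) := by
  unfold normSq
  simp only [coe_nnnorm_sq_eq_ofReal]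
  have hint : Integrable (fun X : Config m => ‖sectorWave L e B m X‖ ^ 2)
      (volume.restrict (cellN m L)) := by
    have hI := integrableOn_cellN_of_bounded L
      (F := fun X => (((‖sectorWave L e B m X‖ ^ 2 : ℝ)) : ℂ))
      (by
        have := continuous_sectorWave L e B m
        fun_prop)
      (M := (∑ k : Fin m → ι, ‖Fock.amp B m k‖) ^ 2) (fun X => by
        rw [Complex.norm_real, Real.norm_of_nonneg (by positivity)]
        exact pow_le_pow_left₀ (norm_nonneg _) (norm_sectorWave_le L e B m X) 2)
    have hI' := hI.re
    simp only [RCLike.re_to_complex, Complex.ofReal_re] at hI'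
    exact hI'
  rw [← ofReal_integral_eq_lintegral_ofReal hint (Filter.Eventually.of_forall fun X => by positivity),
    integral_cellN_norm_sq_sectorWave hL he hB]

/-- `‖r f‖² = r² ‖f‖²` for a real scalar `r`. [folklore] -/
theorem aes_normSq_real_mul (L r : ℝ) {m : ℕ} (f : Config m → ℂ) :
    normSq L (fun X => ((r : ℝ) : ℂ) * f X) = ENNReal.ofReal (r ^ 2) * normSq L f := by
  rw [normSq_const_mul, coe_nnnorm_sq_eq_ofReal, Complex.norm_real, Real.norm_eq_abs, sq_abs]

/-- The dictionary `a(φ_q)(c Ψ_B^{(m+1)}) = c √(L³) Ψ^{(m)}_{∂_q B}` on the band modes (from the landed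
`stub_modeAnSectorWave` and homogeneity of `a(φ)`). [cite: LSSY2005, App. A (A.13)] -/
theorem aes_modeAn_const_mul_sectorWave {M : ℕ} {L : ℝ} (hL : 0 < L) (c : ℂ)
    (B : MvPolynomial ↥(momentumBand M) ℂ) (m : ℕ) (q : ↥(momentumBand M)) :
    modeAn L (planeWaveMode L q.1) (fun Y => c * sectorWave L Subtype.val B (m + 1) Y) =
      fun Y => (c * ((Real.sqrt (L ^ 3) : ℝ) : ℂ)) * sectorWave L Subtype.val (pderiv q B) m Y := by
  have h := (stub_modeAnSectorWave L Subtype.val B m hL Subtype.val_injective).1 q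
  rw [show (fun Y => c * sectorWave L Subtype.val B (m + 1) Y) = c • sectorWave L Subtype.val B (m + 1)
    from rfl, modeAn_smul, h]
  funext Y
  simp only [Pi.smul_apply, smul_eq_mul]
  ring

/-- Book-keeping of the three `ℝ≥0∞` terms into one quotient. [folklore] -/
theorem aes_assemble {ι : Type*} [Fintype ι] (kk q : ι → ℝ) (z : ι → Prop) [DecidablePred z]
    {κ g a P : ℝ} (hκ : 0 ≤ κ) (hg : 0 ≤ g) (ha : 0 < a) (hkk : ∀ p, 0 ≤ kk p) (hq : ∀ p, 0 ≤ q p)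
    (hP : 0 ≤ P) :
    ENNReal.ofReal ((∑ p, kk p * q p) / a) +
        ENNReal.ofReal κ * ENNReal.ofReal ((∑ p, (if z p then 0 else 1) * q p) / a) +
        ENNReal.ofReal (g * (P / a)) =
      ENNReal.ofReal (((∑ p, (kk p + if z p then 0 else κ) * q p) + g * P) / a) := by
  have h1 : 0 ≤ (∑ p, kk p * q p) / a :=
    div_nonneg (Finset.sum_nonneg fun p _ => mul_nonneg (hkk p) (hq p)) ha.le
  have h2 : 0 ≤ κ * ((∑ p, (if z p then 0 else 1) * q p) / a) :=
    mul_nonneg hκ (div_nonneg (Finset.sum_nonneg fun p _ =>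
      mul_nonneg (by split_ifs <;> norm_num) (hq p)) ha.le)
  have h3 : 0 ≤ g * (P / a) := mul_nonneg hg (div_nonneg hP ha.le)
  rw [← ENNReal.ofReal_mul hκ, ← ENNReal.ofReal_add h1 h2, ← ENNReal.ofReal_add (add_nonneg h1 h2) h3]
  congr 1
  have hsum : ∑ p, (kk p + if z p then 0 else κ) * q p =
      ∑ p, kk p * q p + κ * ∑ p, (if z p then 0 else 1) * q p := by
    rw [Finset.mul_sum, ← Finset.sum_add_distrib]
    refine Finset.sum_congr rfl fun p _ => ?_
    split_ifs <;> ring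
  rw [hsum]
  ring

/-! ## The three terms of the anchor functional on a sector trial state -/

/-- **Kinetic term**: `∫|∇Ψ|² = Σ_p |k_p|² ‖∂_p A‖² / ‖A‖²`. [cite: LSSY2005, App. A (A.10)] -/
theorem aes_periodicEnergy_sectorTrialState {M : ℕ} {L : ℝ} (hL : 0 < L) {n : ℕ}
    {A : MvPolynomial ↥(momentumBand M) ℂ} (hA : A.IsHomogeneous (n + 2)) (hA0 : A ≠ 0) :
    periodicEnergy 0 (sectorTrialState hL Subtype.val_injective hA hA0) =
      ENNReal.ofReal ((∑ p : ↥(momentumBand M),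
        ‖waveVector L p.1‖ ^ 2 * (Fock.fockInner (pderiv p A) (pderiv p A)).re) /
          (Fock.fockInner A A).re) := by
  unfold periodicEnergy
  simp only [periodicInteraction_zero, zero_mul, add_zero]
  exact lintegral_kineticDensity_sectorTrialState hL Subtype.val_injective hA hA0

/-- **`a(φ_p)` on the sector trial state**: `a(φ_p) Ψ = c √(L³) Ψ_{∂_p A}`. [cite: LSSY2005, App. A (A.13)] -/
theorem aes_modeAn_sectorTrialState {M : ℕ} {L : ℝ} (hL : 0 < L) {n : ℕ}
    {A : MvPolynomial ↥(momentumBand M) ℂ} (hA : A.IsHomogeneous (n + 2)) (hA0 : A ≠ 0)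
    (p : ↥(momentumBand M)) :
    modeAn L (planeWaveMode L p.1) (sectorTrialState hL Subtype.val_injective hA hA0).ψ =
      fun Y => ((((Real.sqrt ((L ^ 3) ^ (n + 2) * (Fock.fockInner A A).re))⁻¹ : ℝ) : ℂ) *
        ((Real.sqrt (L ^ 3) : ℝ) : ℂ)) * sectorWave L Subtype.val (pderiv p A) (n + 1) Y := by
  have hψ : (sectorTrialState hL Subtype.val_injective hA hA0).ψ =
      fun Y => (((Real.sqrt ((L ^ 3) ^ (n + 2) * (Fock.fockInner A A).re))⁻¹ : ℝ) : ℂ) *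
        sectorWave L Subtype.val A (n + 1 + 1) Y := rfl
  rw [hψ]
  exact aes_modeAn_const_mul_sectorWave hL _ A (n + 1) p

/-- **`a(φ_{-p}) a(φ_p)` on the sector trial state**: `= c L³ Ψ_{∂_{-p}∂_p A}`. [cite: LSSY2005, App. A (A.13)] -/
theorem aes_modeAn_modeAn_sectorTrialState {M : ℕ} {L : ℝ} (hL : 0 < L) {n : ℕ}
    {A : MvPolynomial ↥(momentumBand M) ℂ} (hA : A.IsHomogeneous (n + 2)) (hA0 : A ≠ 0)
    (p : ↥(momentumBand M)) :
    modeAn L (planeWaveMode L (-p.1))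
        (modeAn L (planeWaveMode L p.1) (sectorTrialState hL Subtype.val_injective hA hA0).ψ) =
      fun Y => ((((Real.sqrt ((L ^ 3) ^ (n + 2) * (Fock.fockInner A A).re))⁻¹ : ℝ) : ℂ) *
        ((Real.sqrt (L ^ 3) : ℝ) : ℂ) * ((Real.sqrt (L ^ 3) : ℝ) : ℂ)) *
          sectorWave L Subtype.val (pderiv (-p) (pderiv p A)) n Y := by
  rw [aes_modeAn_sectorTrialState hL hA hA0 p]
  exact aes_modeAn_const_mul_sectorWave hL _ (pderiv p A) n (-p)

/-- **The band pair operator on the sector trial state**: `Σ_{k ∈ B_M} a_{-k} a_k Ψ = c L³ Ψ_{QA}`,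
`QA = Σ_p ∂_{-p}∂_p A`. [cite: LSSY2005, App. A (A.13)] -/
theorem aes_bandPair_sectorTrialState {M : ℕ} {L : ℝ} (hL : 0 < L) {n : ℕ}
    {A : MvPolynomial ↥(momentumBand M) ℂ} (hA : A.IsHomogeneous (n + 2)) (hA0 : A ≠ 0) :
    (fun Y => ∑ k ∈ momentumBand M, modeAn L (planeWaveMode L (-k))
        (modeAn L (planeWaveMode L k) (sectorTrialState hL Subtype.val_injective hA hA0).ψ) Y) =
      fun Y => ((((Real.sqrt ((L ^ 3) ^ (n + 2) * (Fock.fockInner A A).re))⁻¹ : ℝ) : ℂ) *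
        ((Real.sqrt (L ^ 3) : ℝ) : ℂ) * ((Real.sqrt (L ^ 3) : ℝ) : ℂ)) *
          sectorWave L Subtype.val
            (∑ p : ↥(momentumBand M), pderiv (-p) (pderiv p A)) n Y := by
  funext Y
  rw [aes_sectorWave_finset_sum, Finset.mul_sum, ← Finset.sum_coe_sort (momentumBand M)]
  refine Finset.sum_congr rfl fun p _ => ?_
  rw [aes_modeAn_modeAn_sectorTrialState hL hA hA0 p]

/-- **Pair mass**: `‖Σ_{k ∈ B_M} a_{-k} a_k Ψ‖² = ‖QA‖²/‖A‖²`. [cite: LSSY2005, App. A (A.9), (A.13)] -/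
theorem aes_normSq_bandPair {M : ℕ} {L : ℝ} (hL : 0 < L) {n : ℕ}
    {A : MvPolynomial ↥(momentumBand M) ℂ} (hA : A.IsHomogeneous (n + 2)) (hA0 : A ≠ 0) :
    normSq L (fun Y => ∑ k ∈ momentumBand M, modeAn L (planeWaveMode L (-k))
        (modeAn L (planeWaveMode L k) (sectorTrialState hL Subtype.val_injective hA hA0).ψ) Y) =
      ENNReal.ofReal ((Fock.fockInner (∑ p : ↥(momentumBand M), pderiv (-p) (pderiv p A))
          (∑ p : ↥(momentumBand M), pderiv (-p) (pderiv p A))).re / (Fock.fockInner A A).re) := by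
  have hQ : (∑ p : ↥(momentumBand M), pderiv (-p) (pderiv p A)).IsHomogeneous n :=
    IsHomogeneous.sum _ _ _ fun p _ =>
      Fock.isHomogeneous_pderiv_of_succ (Fock.isHomogeneous_pderiv_of_succ hA p) (-p)
  have hL3 : 0 < L ^ 3 := by positivity
  have ha : 0 < (Fock.fockInner A A).re := fockInner_self_re_pos hA0
  have hD : 0 < (L ^ 3) ^ (n + 2) * (Fock.fockInner A A).re := by positivity
  rw [aes_bandPair_sectorTrialState hL hA hA0,
    show ((((Real.sqrt ((L ^ 3) ^ (n + 2) * (Fock.fockInner A A).re))⁻¹ : ℝ) : ℂ) *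
        ((Real.sqrt (L ^ 3) : ℝ) : ℂ) * ((Real.sqrt (L ^ 3) : ℝ) : ℂ)) =
      (((Real.sqrt ((L ^ 3) ^ (n + 2) * (Fock.fockInner A A).re))⁻¹ * Real.sqrt (L ^ 3) *
        Real.sqrt (L ^ 3) : ℝ) : ℂ) by push_cast; ring,
    aes_normSq_real_mul, aes_normSq_sectorWave hL Subtype.val_injective hQ,
    ← ENNReal.ofReal_mul (sq_nonneg _)]
  congr 1
  rw [mul_pow, mul_pow, inv_pow, Real.sq_sqrt hD.le, Real.sq_sqrt hL3.le]
  field_simp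
  ring

/-- **Pair term**: `(γ/L⁹)(N(N−1)/2) ∫|∫∫ conj(w_M) Ψ|² = (γ/2L³) ‖QA‖²/‖A‖²`. [cite: LSSY2005, App. A (A.13)] -/
theorem aes_pairTerm_sectorTrialState {M : ℕ} {L γ : ℝ} (hL : 0 < L) (hγ : 0 ≤ γ) {n : ℕ}
    {A : MvPolynomial ↥(momentumBand M) ℂ} (hA : A.IsHomogeneous (n + 2)) (hA0 : A ≠ 0) :
    ENNReal.ofReal (γ / L ^ 9 * (((n + 2 : ℕ) : ℝ) * ((n + 2 : ℕ) - 1) / 2)) *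
        (∫⁻ Y in cellN n L, (‖∫ x in cell L, ∫ y in cell L,
          (starRingEnd ℂ) (bandKernel L M x y) *
            (sectorTrialState hL Subtype.val_injective hA hA0).ψ
              (Matrix.vecCons x (Matrix.vecCons y Y))‖₊ : ℝ≥0∞) ^ 2) =
      ENNReal.ofReal (γ / (2 * L ^ 3) *
        ((Fock.fockInner (∑ p : ↥(momentumBand M), pderiv (-p) (pderiv p A))
          (∑ p : ↥(momentumBand M), pderiv (-p) (pderiv p A))).re / (Fock.fockInner A A).re)) := by
  rw [(stub_bandKineticLower L γ n M hL hγ (sectorTrialState hL Subtype.val_injective hA hA0)).2.2,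
    aes_normSq_bandPair hL hA hA0, ← ENNReal.ofReal_mul (by positivity)]

/-- **Condensate occupation**: `n₀(Ψ) = ‖∂_0 A‖²/‖A‖²`. [cite: LSSY2005, App. A (A.9), (A.13)] -/
theorem aes_condensateOccupation_sectorTrialState {M : ℕ} {L : ℝ} (hL : 0 < L) {n : ℕ}
    {A : MvPolynomial ↥(momentumBand M) ℂ} (hA : A.IsHomogeneous (n + 2)) (hA0 : A ≠ 0) :
    condensateOccupation (n + 2) L (sectorTrialState hL Subtype.val_injective hA hA0).ψ =
      ENNReal.ofReal ((Fock.fockInner (pderiv ⟨0, zero_mem_momentumBand M⟩ A)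
          (pderiv ⟨0, zero_mem_momentumBand M⟩ A)).re / (Fock.fockInner A A).re) := by
  have hL3 : 0 < L ^ 3 := by positivity
  have ha : 0 < (Fock.fockInner A A).re := fockInner_self_re_pos hA0
  have hD : 0 < (L ^ 3) ^ (n + 2) * (Fock.fockInner A A).re := by positivity
  have h0 : modeAn L (planeWaveMode L 0) (sectorTrialState hL Subtype.val_injective hA hA0).ψ =
      fun Y => ((((Real.sqrt ((L ^ 3) ^ (n + 2) * (Fock.fockInner A A).re))⁻¹ : ℝ) : ℂ) *
        ((Real.sqrt (L ^ 3) : ℝ) : ℂ)) *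
          sectorWave L Subtype.val (pderiv ⟨0, zero_mem_momentumBand M⟩ A) (n + 1) Y :=
    aes_modeAn_sectorTrialState hL hA hA0 ⟨0, zero_mem_momentumBand M⟩
  rw [condensateOccupation_eq_normSq_modeAn hL, h0,
    show ((((Real.sqrt ((L ^ 3) ^ (n + 2) * (Fock.fockInner A A).re))⁻¹ : ℝ) : ℂ) *
        ((Real.sqrt (L ^ 3) : ℝ) : ℂ)) =
      (((Real.sqrt ((L ^ 3) ^ (n + 2) * (Fock.fockInner A A).re))⁻¹ * Real.sqrt (L ^ 3) : ℝ) : ℂ) by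
      push_cast; ring,
    aes_normSq_real_mul,
    aes_normSq_sectorWave hL Subtype.val_injective (Fock.isHomogeneous_pderiv_of_succ hA _),
    ← ENNReal.ofReal_mul (sq_nonneg _)]
  congr 1
  rw [mul_pow, inv_pow, Real.sq_sqrt hD.le, Real.sq_sqrt hL3.le]
  field_simp
  ring

/-- **Depletion**: `N − n₀(Ψ) = Σ_{p ≠ 0} ‖∂_p A‖²/‖A‖²` (Euler: `Σ_p ‖∂_p A‖² = N ‖A‖²`).
[cite: LSSY2005, App. A (A.9), (A.13)] -/
theorem aes_depletion_sectorTrialState {M : ℕ} {L : ℝ} (hL : 0 < L) {n : ℕ}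
    {A : MvPolynomial ↥(momentumBand M) ℂ} (hA : A.IsHomogeneous (n + 2)) (hA0 : A ≠ 0) :
    ((n + 2 : ℕ) : ℝ≥0∞) - condensateOccupation (n + 2) L (sectorTrialState hL Subtype.val_injective hA hA0).ψ =
      ENNReal.ofReal ((∑ p : ↥(momentumBand M), (if p.1 = 0 then 0 else 1) *
          (Fock.fockInner (pderiv p A) (pderiv p A)).re) / (Fock.fockInner A A).re) := by
  have ha : 0 < (Fock.fockInner A A).re := fockInner_self_re_pos hA0
  rw [aes_condensateOccupation_sectorTrialState hL hA hA0, ← ENNReal.ofReal_natCast,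
    ← ENNReal.ofReal_sub _ (div_nonneg (Fock.fockInner_self_re_nonneg _) ha.le)]
  congr 1
  have hE := congrArg Complex.re (Fock.sum_fockInner_pderiv_pderiv hA A)
  rw [Complex.re_sum, ← Complex.ofReal_natCast, Complex.re_ofReal_mul] at hE
  rw [eq_div_iff ha.ne', sub_mul, div_mul_cancel₀ _ ha.ne', ← hE,
    ← Finset.add_sum_erase _ _ (Finset.mem_univ (⟨0, zero_mem_momentumBand M⟩ : ↥(momentumBand M))),
    ← Finset.add_sum_erase _ (fun p : ↥(momentumBand M) => (if p.1 = 0 then (0 : ℝ) else 1) *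
      (Fock.fockInner (pderiv p A) (pderiv p A)).re)
      (Finset.mem_univ (⟨0, zero_mem_momentumBand M⟩ : ↥(momentumBand M)))]
  rw [if_pos rfl, zero_mul, zero_add, add_sub_cancel_left]
  refine Finset.sum_congr rfl fun p hp => ?_
  have hp' : (p : Momentum) ≠ 0 := fun h => (Finset.mem_erase.1 hp).1 (Subtype.ext h)
  rw [if_neg hp', one_mul]

/-! ## The stub -/

/-- **Stub U1 — the anchor functional of a sector trial state.** For `γ, κ ≥ 0`, `ρ > 0`,
`M = ⌊Λ L_N(ρ)/2π⌋` and a non-zero homogeneous `A` of degree `N = n + 2` over the band modes,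
`E_κ(Ψ_A/‖Ψ_A‖) ≤ [Σ_p (|k_p|² + κ[p ≠ 0]) ‖∂_p A‖² + (γ/2L³) ‖Σ_p ∂_{-p}∂_p A‖²] / ‖A‖²`
(with equality; the three terms are `aes_periodicEnergy_sectorTrialState`,
`aes_depletion_sectorTrialState`, `aes_pairTerm_sectorTrialState`). [cite: LSSY2005, App. A (A.9)–(A.13)] -/
theorem stub_anchorESector :
    ∀ (γ κ ρ Λ : ℝ) (n M : ℕ) (hρ : 0 < ρ) (A : MvPolynomial ↥(momentumBand M) ℂ)
      (hA : A.IsHomogeneous (n + 2)) (hA0 : A ≠ 0),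
      0 ≤ γ → 0 ≤ κ → M = ⌊Λ * sideLength ρ (n + 2) / (2 * Real.pi)⌋₊ →
      anchorE γ κ ρ n Λ (sectorTrialState (sideLength_succ_succ_pos hρ n) Subtype.val_injective hA hA0) ≤
        ENNReal.ofReal
          (((∑ p : ↥(momentumBand M),
              (‖waveVector (sideLength ρ (n + 2)) p.1‖ ^ 2 + if p.1 = 0 then 0 else κ) *
                (Fock.fockInner (MvPolynomial.pderiv p A) (MvPolynomial.pderiv p A)).re) +
            γ / (2 * sideLength ρ (n + 2) ^ 3) *
              (Fock.fockInner
                (∑ p : ↥(momentumBand M), MvPolynomial.pderiv (-p) (MvPolynomial.pderiv p A))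
                (∑ p : ↥(momentumBand M), MvPolynomial.pderiv (-p) (MvPolynomial.pderiv p A))).re) /
          (Fock.fockInner A A).re) := by
  intro γ κ ρ Λ n M hρ A hA hA0 hγ hκ hM
  subst hM
  rw [anchorE_eq, aes_periodicEnergy_sectorTrialState (sideLength_succ_succ_pos hρ n) hA hA0,
    aes_depletion_sectorTrialState (sideLength_succ_succ_pos hρ n) hA hA0,
    aes_pairTerm_sectorTrialState (sideLength_succ_succ_pos hρ n) hγ hA hA0]
  exact le_of_eq (aes_assemble (fun p : ↥(momentumBand ⌊Λ * sideLength ρ (n + 2) / (2 * Real.pi)⌋₊) =>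
      ‖waveVector (sideLength ρ (n + 2)) p.1‖ ^ 2)
    (fun p => (Fock.fockInner (pderiv p A) (pderiv p A)).re) (fun p => p.1 = 0) hκ
    (by have := sideLength_succ_succ_pos hρ n; positivity) (fockInner_self_re_pos hA0)
    (fun p => sq_nonneg _) (fun p => Fock.fockInner_self_re_nonneg _) (Fock.fockInner_self_re_nonneg _))

end Summit.AtomisticToContinuum.BoseEinsteinCondensation.Cruxes.RichardsonAnchorBEC.Birth

end
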